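import Summits.QuantumAdvantage.QuantumAdvantage.Theorems.SosSandwichTransferPBKeyedLanguage
import Literature.Computability.Complexity.FoldBricks
import Literature.Computability.Complexity.CodeFPArith
import HarnessLib

/-!
# Crux `TransferPB` (stmt-QuantumAdvantage-15238, route SosSandwich), line `birth` — the padded LAYOUT of node-test instances is polynomial time

Obligation (Q) of stub `stub_pbOracleSimulation` (`nodeProblem F r c k ∈ PromiseBQP`). The quantum estimator is the
keyed-oracle family run on a PRE-PROCESSED instance (`PolyThreshold.mem_PromiseBQP_of_thresholds_pre` /
`PolyBlockStatReadout.mem_PromiseBQP_of_blockStat_thresholds_pre`: a classical `h ∈ FP` re-encodes the instance into a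
layout whose LENGTH fixes the circuit's size parameters). `Theorems/SosSandwichTransferPBKeyedLanguage.lean` fixed the
layout's shape `layout F x ρ t pad = x ++ paramStr ⟨x, ⟨encPath ρ, t⟩⟩ pad` and proved the estimator's semantics under
the hypothesis `nOf |layout| = |x|`. This file supplies the classical side:

* `padPoly = 2X² + 7X + 6` (`= 2(|v|+2)² − |v| − 2`), **`layoutFn`** — the string function
  `v ↦ fstF v ++ paramStr v 1^{padPoly(|v|)}` (bricks `appF`, `fanoutFn`, `fstF`, `polyFn`); `layoutFn_mem_FP`;
* `length_layoutFn_boolPair` — on an instance `v = ⟨x, w⟩` the layout has length `|x| + s²` with `s = 2|v| + 4 ≥ |x|`;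
* **`nOfLayout L = L − ⌊√L⌋²`** reads `|x|` off the layout length: `nOfLayout_length_layoutFn` (`Nat.sqrt_add_eq'`),
  `nOfLayout_le`; **`codeFP_nOfLayout`** — computed on unary codes (`CodeFP.natSqrt`, `natMul`, `natSub`, `unOfNatMin`),
  the form `KeyedRun.family_isUniform` consumes;
* **`layoutFn_encBlock` / `layoutFn_encSingle` / `layoutFn_encMean`** — on the three kinds of node-test instances the
  layout IS `layout F x ρ t pad` (with the instance's tag-and-target `t`), and `nOfLayout |layoutFn v| = |x|`
  (`nOfLayout_enc*`), so the semantic theorems `kernelProb_keyedRun_event_eq_avg` /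
  `kernelProb_keyedRun_accept_eq_nodeMean` apply to `z = layoutFn v` with `nOf = nOfLayout`.

All proved; the definitions are explicit string / arithmetic functions. No named fact. Sources: E. Bernstein,
U. Vazirani, SIAM J. Comput. 26 (1997), §8 (classical pre-processing); S. Arora, B. Barak, Computational Complexity
(CUP 2009), §1.3, §0.1.
-/

-- D-0017: single-conjunct summit ⇒ the duplicate `QuantumAdvantage.QuantumAdvantage` is mandated.
set_option linter.dupNamespace false

noncomputable section

namespace Summit.QuantumAdvantage.QuantumAdvantage.Cruxes.TransferPB.Birth

open Finset Literature.Computability.Cryptography Literature.Computability.Complexity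
  Literature.Computability.Complexity.Brick Literature.Computability.Complexity.Plumb
  Literature.Computability.QuantumComplexity Literature.Computability.QuantumComplexity.ClassicalSimulation
open _root_.Computability Polynomial

namespace SimTreePB

/-! ### The layout string function -/

/-- The padding length polynomial `2X² + 7X + 6 = 2(X+2)² − X − 2` (so that the parameter string has the square length
`(2|v|+4)²`). -/
def padPoly : Polynomial ℕ := 2 * X ^ 2 + 7 * X + 6

/-- Value of `padPoly`. -/
theorem padPoly_eval (n : ℕ) : padPoly.eval n = 2 * n ^ 2 + 7 * n + 6 := by
  simp [padPoly]

/-- **The layout string function**: `v ↦ fstF v ++ paramStr v 1^{padPoly(|v|)}` — the first component `x` of the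
instance, then the self-delimiting parameter string carrying the whole instance and the padding. -/
def layoutFn : List Bool → List Bool :=
  appF ∘ fanoutFn fstF (fanoutFn (fun v => v) (fanoutFn (polyFn padPoly) (fun _ => [])))

/-- Value of the layout function. -/
theorem layoutFn_apply (v : List Bool) : layoutFn v = fstF v ++ paramStr v (ones (padPoly.eval v.length)) := by
  simp [layoutFn, paramStr]

/-- **The layout function is polynomial time.** -/
theorem layoutFn_mem_FP : layoutFn ∈ FP :=
  comp_mem_FP appF_mem_FP (fanoutFn_mem_FP fstF_mem_FP (fanoutFn_mem_FP (PolyTimeComputable.id _)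
    (fanoutFn_mem_FP (polyFn_mem_FP _) (const_mem_FP _))))

/-- The side of the square: `s = 2|v| + 4`. -/
def side (v : List Bool) : ℕ := 2 * v.length + 4

/-- The parameter string of the layout has length `s²`. -/
theorem length_paramStr_layout (v : List Bool) :
    (paramStr v (ones (padPoly.eval v.length))).length = side v ^ 2 := by
  simp only [paramStr, length_boolPair, ones, List.length_replicate, padPoly_eval, List.length_nil, side]
  ring

/-- **Length of the layout of an instance `⟨x, w⟩`**: `|x| + s²`. -/
theorem length_layoutFn_boolPair (x w : List Bool) :
    (layoutFn (boolPair x w)).length = x.length + side (boolPair x w) ^ 2 := by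
  rw [layoutFn_apply, List.length_append, fstF_boolPair, length_paramStr_layout]

/-- `|x| ≤ s` for an instance `⟨x, w⟩`. -/
theorem length_le_side (x w : List Bool) : x.length ≤ side (boolPair x w) := by
  simp only [side, length_boolPair]; omega

/-! ### Reading `|x|` off the layout length -/

/-- **The input length read off the layout length**: `nOfLayout L = L − ⌊√L⌋²`. -/
def nOfLayout (L : ℕ) : ℕ := L - Nat.sqrt L * Nat.sqrt L

/-- `nOfLayout L ≤ L`. -/
theorem nOfLayout_le (L : ℕ) : nOfLayout L ≤ L := Nat.sub_le _ _

/-- `nOfLayout (n + s²) = n` for `n ≤ s` (indeed `n ≤ 2s`). -/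
theorem nOfLayout_add_sq {n s : ℕ} (h : n ≤ s) : nOfLayout (n + s ^ 2) = n := by
  have hs : Nat.sqrt (s * s + n) = s := Nat.sqrt_add_eq s (by omega)
  rw [nOfLayout, show n + s ^ 2 = s * s + n by ring, hs]
  omega

/-- **The layout length determines `|x|`.** -/
theorem nOfLayout_length_layoutFn (x w : List Bool) : nOfLayout (layoutFn (boolPair x w)).length = x.length := by
  rw [length_layoutFn_boolPair, nOfLayout_add_sq (length_le_side x w)]

/-- **`nOfLayout` is computed on unary codes** (binary square root, product, difference, then back to unary under the
budget `L`). -/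
theorem codeFP_nOfLayout : CodeFP CodeFP.unE CodeFP.unE nOfLayout := by
  have hL : CodeFP CodeFP.unE CodeFP.natE (fun L => L) := CodeFP.natOfUn
  have hs : CodeFP CodeFP.unE CodeFP.natE (fun L => Nat.sqrt L) := CodeFP.natSqrt.comp hL
  have hsq : CodeFP CodeFP.unE CodeFP.natE (fun L => Nat.sqrt L * Nat.sqrt L) := CodeFP.natMul.comp (hs.pair hs)
  have hd : CodeFP CodeFP.unE CodeFP.natE (fun L => L - Nat.sqrt L * Nat.sqrt L) := CodeFP.natSub.comp (hL.pair hsq)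
  exact (CodeFP.unOfNatMin.comp ((CodeFP.id CodeFP.unE).pair hd)).congr fun L => by
    simp only [nOfLayout]
    exact min_eq_left (Nat.sub_le _ _)

/-! ### The layout of the three kinds of node-test instances -/

variable (F : QCircuitFamily cliffordT) (x : List Bool) (ρ : List (Fin (numOracleBits F x) × Bool))

/-- **The layout of a BLOCK instance** is `layout F x ρ (00u) pad`. -/
theorem layoutFn_encBlock (u : List Bool) :
    layoutFn (encBlock F x ρ u) =
      layout F x ρ (false :: false :: u) (ones (padPoly.eval (encBlock F x ρ u).length)) := by
  rw [layoutFn_apply, encBlock, fstF_boolPair, layout]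

/-- **The layout of a SINGLE instance** is `layout F x ρ (01σ(s)) pad`. -/
theorem layoutFn_encSingle (s : Fin (numOracleBits F x)) :
    layoutFn (encSingle F x ρ s) =
      layout F x ρ (false :: true :: bitString F x s) (ones (padPoly.eval (encSingle F x ρ s).length)) := by
  rw [layoutFn_apply, encSingle, fstF_boolPair, layout]

/-- **The layout of a MEAN instance** is `layout F x ρ (1 1^j) pad`. -/
theorem layoutFn_encMean (j : ℕ) :
    layoutFn (encMean F x ρ j) =
      layout F x ρ (true :: List.replicate j true) (ones (padPoly.eval (encMean F x ρ j).length)) := by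
  rw [layoutFn_apply, encMean, fstF_boolPair, layout]

/-- The layout length of a BLOCK instance determines `|x|`. -/
theorem nOfLayout_encBlock (u : List Bool) : nOfLayout (layoutFn (encBlock F x ρ u)).length = x.length :=
  nOfLayout_length_layoutFn x _

/-- The layout length of a SINGLE instance determines `|x|`. -/
theorem nOfLayout_encSingle (s : Fin (numOracleBits F x)) : nOfLayout (layoutFn (encSingle F x ρ s)).length = x.length :=
  nOfLayout_length_layoutFn x _

/-- The layout length of a MEAN instance determines `|x|`. -/
theorem nOfLayout_encMean (j : ℕ) : nOfLayout (layoutFn (encMean F x ρ j)).length = x.length :=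
  nOfLayout_length_layoutFn x _

/-- **The MEAN node test through the layout**: the keyed family (`nOf = nOfLayout`, oracle `keyedLang F`) run on
`layoutFn ⟨x, ρ, j⟩` accepts on the transported answer wire with probability EXACTLY `nodeMean F x ρ`. -/
theorem kernelProb_keyedRun_layoutFn_encMean (j : ℕ) :
    (keyedRun F nOfLayout nOfLayout_le).family.kernelProb (keyedLang F) (layoutFn (encMean F x ρ j))
        {s | [true] <+: readRun (keyedRun F nOfLayout nOfLayout_le) (layoutFn (encMean F x ρ j)) s} =
      nodeMean F x ρ := by
  have hx := nOfLayout_encMean F x ρ j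
  rw [layoutFn_encMean] at hx ⊢
  exact kernelProb_keyedRun_accept_eq_nodeMean nOfLayout nOfLayout_le x ρ _ _ hx

end SimTreePB

end Summit.QuantumAdvantage.QuantumAdvantage.Cruxes.TransferPB.Birth

end
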